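/-
Copyright (c) 2026. Released under Apache 2.0 license as described in the file LICENSE.
-/
import Literature.Analysis.ValidatedNumerics.MultiPrecisionInterval
import Literature.NumberTheory.LFunctions.Xiao2020.CertKernel
import HarnessLib

/-!
# Xiao (2020), Conj. 3.4 — soundness of the interval certificate, I: enclosure lemmas

`Xiao2020.CertKernel` is a program over integer-endpoint interval boxes `MI` (value `x` lies in box
`I` at scale `S` iff `I.lo ≤ x·S ≤ I.hi`).  This file introduces the predicate
`CertKernel.Encl S f L` ("the `i`-th box of the list `L` contains `f i`") and proves what the
generic list programs of the kernel enclose: power rows `trow`, the logarithm table `logsList`,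
the `Σₙ n^{-(1+w)}` pass `aPass`, the shifted convolution `dPass`, the Cauchy widening
`widenPass`, the `q`-recursion `qPass`, and the exact boxes `ratBox` / `fracBox` / `zfracBox`.
Continued in `Xiao2020.CertTables` and `Xiao2020.CertSound`.  Reference for the target statement:
[Xiao2020, Conj. 3.4].
-/

namespace Literature.NumberTheory.LFunctions.Xiao2020

open Literature.Analysis.ValidatedNumerics Literature.Analysis.ValidatedNumerics.NumericsMP Finset
open scoped Nat

/-! ## Generic enclosure lemmas for the list programs -/

namespace CertKernel

variable {S : ℕ}

/-- `Encl S f L`: the `i`-th box of `L` contains `f i`, for every `i < L.length`. [folklore] -/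
def Encl (S : ℕ) (f : ℕ → ℝ) : List MI → Prop
  | [] => True
  | I :: L => MI.mem S (f 0) I ∧ Encl S (fun i ↦ f (i + 1)) L

/-- [folklore] -/
@[simp] lemma encl_nil {f : ℕ → ℝ} : Encl S f [] := trivial

/-- [folklore] -/
lemma encl_cons {f : ℕ → ℝ} {I : MI} {L : List MI} :
    Encl S f (I :: L) ↔ MI.mem S (f 0) I ∧ Encl S (fun i ↦ f (i + 1)) L := Iff.rfl

/-- [folklore] -/
lemma mem_zeroI (S : ℕ) : MI.mem S 0 zeroI := by simp [MI.mem, zeroI]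

/-- [folklore] -/
lemma encl_iff_getD {f : ℕ → ℝ} {L : List MI} :
    Encl S f L ↔ ∀ i < L.length, MI.mem S (f i) (L.getD i zeroI) := by
  induction L generalizing f with
  | nil => simp
  | cons I L ih =>
    rw [encl_cons, ih]
    constructor
    · rintro ⟨h0, h⟩ i hi
      cases i with
      | zero => simpa using h0
      | succ i => simpa using h i (by simpa using hi)
    · intro h
      exact ⟨by simpa using h 0 (by simp), fun i hi ↦ by simpa using h (i + 1) (by simpa using hi)⟩

/-- [folklore] -/
lemma Encl.getD {f : ℕ → ℝ} {L : List MI} (h : Encl S f L) {i : ℕ} (hi : i < L.length) :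
    MI.mem S (f i) (L.getD i zeroI) := encl_iff_getD.1 h i hi

/-- [folklore] -/
lemma Encl.congr {f g : ℕ → ℝ} {L : List MI} (h : Encl S f L) (hfg : ∀ i < L.length, f i = g i) :
    Encl S g L :=
  encl_iff_getD.2 fun i hi ↦ hfg i hi ▸ h.getD hi

/-- [folklore] -/
lemma Encl.congr' {f g : ℕ → ℝ} {L : List MI} (h : Encl S f L) (hfg : ∀ i, f i = g i) :
    Encl S g L := h.congr fun i _ ↦ hfg i

/-- [folklore] -/
lemma encl_reverse {f : ℕ → ℝ} {L : List MI} (h : Encl S f L) :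
    Encl S (fun i ↦ f (L.length - 1 - i)) L.reverse := by
  rw [encl_iff_getD] at h ⊢
  intro i hi
  rw [List.length_reverse] at hi
  have := h (L.length - 1 - i) (by omega)
  rw [List.getD_eq_getElem?_getD, List.getElem?_reverse hi, ← List.getD_eq_getElem?_getD]
  exact this

/-- [folklore] -/
lemma encl_append_single {f : ℕ → ℝ} {L : List MI} {y : MI} (h : Encl S f L)
    (hy : MI.mem S (f L.length) y) : Encl S f (L ++ [y]) := by
  induction L generalizing f with
  | nil => exact ⟨hy, trivial⟩
  | cons I L ih => exact ⟨h.1, ih h.2 (by simpa using hy)⟩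

/-- [folklore] -/
@[simp] lemma length_addL (L M : List MI) : (addL L M).length = min L.length M.length := by
  simp [addL]

/-- [folklore] -/
lemma encl_addL {f g : ℕ → ℝ} {L M : List MI} (hf : Encl S f L) (hg : Encl S g M) :
    Encl S (fun i ↦ f i + g i) (addL L M) := by
  induction L generalizing f g M with
  | nil => simp [addL]
  | cons I L ih =>
    cases M with
    | nil => simp [addL]
    | cons J M =>
      simp only [addL, List.zipWith_cons_cons, encl_cons] at hf hg ⊢
      exact ⟨MI.mem_add hf.1 hg.1, ih hf.2 hg.2⟩

/-- [folklore] -/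
lemma mem_dot (hS : 0 < S) {a b : ℕ → ℝ} {G T : List MI} (ha : Encl S a G) (hb : Encl S b T) :
    MI.mem S (∑ l ∈ Finset.range (min G.length T.length), a l * b l) (dot S G T) := by
  induction G generalizing a b T with
  | nil =>
    simp only [dot, List.length_nil, Nat.zero_min, Finset.range_zero, Finset.sum_empty]
    exact mem_zeroI S
  | cons g G ih =>
    cases T with
    | nil =>
      simp only [dot, List.length_nil, Nat.min_zero, Finset.range_zero, Finset.sum_empty]
      exact mem_zeroI S
    | cons t T =>
      simp only [dot, List.length_cons, Nat.succ_min_succ] 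
      rw [Finset.sum_range_succ']
      simpa [add_comm] using MI.mem_add (MI.mem_mul hS ha.1 hb.1) (ih ha.2 hb.2)

/-- [folklore] -/
lemma mem_dotZ {a : ℕ → ℝ} {A : List MI} (E : List ℤ) (ha : Encl S a A) :
    MI.mem S (∑ k ∈ Finset.range (min E.length A.length), (E.getD k 0 : ℝ) * a k) (dotZ E A) := by
  induction E generalizing a A with
  | nil =>
    simp only [dotZ, List.length_nil, Nat.zero_min, Finset.range_zero, Finset.sum_empty]
    exact mem_zeroI S
  | cons e E ih =>
    cases A with
    | nil =>
      simp only [dotZ, List.length_nil, Nat.min_zero, Finset.range_zero, Finset.sum_empty]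
      exact mem_zeroI S
    | cons I A =>
      simp only [dotZ, List.length_cons, Nat.succ_min_succ]
      rw [Finset.sum_range_succ']
      simp only [List.getD_cons_succ, List.getD_cons_zero]
      have := MI.mem_add (MI.mem_mulInt ha.1 e) (ih ha.2)
      simpa [add_comm, mul_comm] using this

/-- [folklore] -/
lemma encl_map_divNat {f : ℕ → ℝ} {L : List MI} (hf : Encl S f L) {n : ℕ} (hn : 0 < n) :
    Encl S (fun i ↦ f i / n) (L.map fun t ↦ t.divNat n) := by
  induction L generalizing f with
  | nil => simp
  | cons I L ih => exact ⟨MI.mem_divNat hf.1 hn, ih hf.2⟩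

/-- [folklore] -/
@[simp] lemma length_tabulate (F : ℕ → MI) (k c : ℕ) : (tabulate F k c).length = c := by
  induction c generalizing k with
  | zero => rfl
  | succ c ih => simp [tabulate, ih]

/-- [folklore] -/
lemma encl_tabulate {F : ℕ → MI} {f : ℕ → ℝ} {B : ℕ} (h : ∀ k < B, MI.mem S (f k) (F k)) :
    ∀ (k c : ℕ), k + c ≤ B → Encl S (fun i ↦ f (k + i)) (tabulate F k c)
  | _, 0, _ => trivial
  | k, c + 1, hkc => ⟨by simpa using h k (by omega),
      (encl_tabulate h (k + 1) c (by omega)).congr' fun i ↦ by simp [add_assoc, add_comm 1 i]⟩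

/-- [folklore] -/
lemma mem_ratBox (S : ℕ) (q : ℚ) : MI.mem S (q : ℝ) (ratBox S q) := by
  have := MI.mem_ofFrac S q.num q.den_pos
  rwa [← Rat.cast_def] at this
  
/-- [folklore] -/
lemma le_ceilScaled (S : ℕ) (q : ℚ) : (q : ℝ) * S ≤ (ceilScaled S q : ℝ) := by
  have h := Numerics.le_cdiv_mul_real (a := q.num * S) (b := q.den) (by exact_mod_cast q.den_pos)
  have hd : (0 : ℝ) < q.den := by exact_mod_cast q.den_pos
  rw [ceilScaled]
  rw [Rat.cast_def, div_mul_eq_mul_div, div_le_iff₀ hd]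
  exact_mod_cast h

/-- [folklore] -/
lemma mem_fracBox (S p : ℕ) {q : ℕ} (hq : 0 < q) : MI.mem S ((p : ℝ) / q) (fracBox S p q) := by
  have hq' : (0 : ℝ) < q := by exact_mod_cast hq
  have h1 : ((p * S / q : ℕ) : ℝ) * q ≤ ((p * S : ℕ) : ℝ) := by
    exact_mod_cast Nat.div_mul_le_self (p * S) q
  have h2 : ((p * S : ℕ) : ℝ) < ((p * S / q : ℕ) : ℝ) * q + q := by
    exact_mod_cast Nat.lt_div_mul_add hq
  simp only [MI.mem, fracBox, Int.cast_natCast, Int.cast_add, Int.cast_one]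
  rw [div_mul_eq_mul_div, le_div_iff₀ hq', div_le_iff₀ hq']
  push_cast at h1 h2 ⊢
  constructor <;> nlinarith

/-- [folklore] -/
lemma mem_zfracBox (S : ℕ) (p : ℤ) {q : ℕ} (hq : 0 < q) :
    MI.mem S ((p : ℝ) / q) (zfracBox S p q) := by
  unfold zfracBox
  split_ifs with hp
  · have := mem_fracBox S p.toNat hq
    rwa [show ((p.toNat : ℕ) : ℝ) = (p : ℝ) by exact_mod_cast Int.toNat_of_nonneg hp] at this
  · have := MI.mem_neg (mem_fracBox S (-p).toNat hq)
    rwa [show ((((-p).toNat : ℕ) : ℝ)) = -(p : ℝ) by exact_mod_cast Int.toNat_of_nonneg (by omega),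
      neg_div, neg_neg] at this

/-! ### The power rows -/

/-- [folklore] -/
@[simp] lemma length_trowFrom (S : ℕ) (X : MI) : ∀ (cur : MI) (j c : ℕ),
    (trowFrom S X cur j c).length = c
  | _, _, 0 => rfl
  | cur, j, c + 1 => by simp [trowFrom, length_trowFrom]

/-- [folklore] -/
lemma encl_trowFrom (hS : 0 < S) {x : ℝ} {X : MI} (hX : MI.mem S x X) :
    ∀ (c j : ℕ) (cur : MI), MI.mem S (x ^ j / j !) cur →
      Encl S (fun i ↦ x ^ (j + i) / (j + i)!) (trowFrom S X cur j c)
  | 0, _, _, _ => trivial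
  | c + 1, j, cur, h => by
    refine ⟨by simpa using h, ?_⟩
    have hnext : MI.mem S (x ^ (j + 1) / (j + 1)!) ((cur.mul S X).divNat (j + 1)) := by
      have := MI.mem_divNat (MI.mem_mul hS h hX) (n := j + 1) (by omega)
      convert this using 1
      rw [Nat.factorial_succ, pow_succ]; push_cast
      field_simp
    exact (encl_trowFrom hS hX c (j + 1) _ hnext).congr' fun i ↦ by
      simp only [add_assoc, add_comm 1 i]

/-- [folklore] -/
lemma encl_trow (hS : 0 < S) {x : ℝ} {X : MI} (hX : MI.mem S x X) (len : ℕ) :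
    Encl S (fun i ↦ x ^ i / i !) (trow S X len) := by
  have := encl_trowFrom hS hX len 0 (MI.ofInt S 1) (by simpa using MI.mem_ofInt S 1)
  simpa [trow] using this

/-- [folklore] -/
@[simp] lemma length_trow (S : ℕ) (X : MI) (len : ℕ) : (trow S X len).length = len := by
  simp [trow]

/-! ### The logarithm table -/

/-- [folklore] -/
lemma logsList_spec (hS : 0 < S) (K : ℕ) : ∀ (n : ℕ) (L : List MI), logsList S K n = some L →
    L.length = n ∧ Encl S (fun i ↦ Real.log ((i + 1 : ℕ) : ℝ)) L
  | 0, L, h => by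
    simp only [logsList, Option.some.injEq] at h
    subst h; exact ⟨rfl, trivial⟩
  | n + 1, L, h => by
    simp only [logsList] at h
    split at h
    · rename_i L' y hL' hy
      simp only [Option.some.injEq] at h
      subst h
      obtain ⟨hlen, hencl⟩ := logsList_spec hS K n L' hL'
      refine ⟨by simp [hlen], encl_append_single hencl ?_⟩
      rw [hlen]
      exact MI.mem_logNat hS hy
    · simp at h

/-! ### The `Σₙ n^{-(1+w)}` part -/

/-- The `i`-th coefficient of `n^{-(1+w)} = n^{-1} e^{-w log n}` shifted by one (the factor `w` of
`ζ₁(1+w) = w ζ(1+w)`): `[1 ≤ i] (−log n)^{i−1} / ((i−1)! · n)`. [folklore] -/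
noncomputable def aTerm (n i : ℕ) : ℝ := if 1 ≤ i then (-Real.log n) ^ (i - 1) / (i - 1)! / n else 0

/-- [folklore] -/
lemma length_aPass (S len : ℕ) : ∀ (Ls : List MI) (n0 : ℕ) (acc : List MI),
    acc.length = len + 1 → (aPass S len Ls n0 acc).length = len + 1
  | [], _, _, h => h
  | L :: Ls, n0, acc, h => by
    simp only [aPass]
    exact length_aPass S len Ls (n0 + 1) _ (by simp [h])

/-- [folklore] -/
lemma encl_aPass (hS : 0 < S) (len : ℕ) : ∀ (Ls : List MI) (n0 : ℕ) (acc : List MI) (g : ℕ → ℝ),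
    1 ≤ n0 → Encl S (fun i ↦ Real.log ((n0 + i : ℕ) : ℝ)) Ls → Encl S g acc →
    Encl S (fun i ↦ g i + ∑ n ∈ Finset.Ico n0 (n0 + Ls.length), aTerm n i) (aPass S len Ls n0 acc)
  | [], n0, acc, g, _, _, hacc => by simpa [aPass] using hacc
  | L :: Ls, n0, acc, g, hn0, hLs, hacc => by
    simp only [aPass]
    have hL : MI.mem S (Real.log n0) L := by simpa using hLs.1
    have hrow : Encl S (fun i ↦ aTerm n0 i)
        (zeroI :: (trow S L.neg len).map fun t ↦ t.divNat n0) := by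
      refine ⟨by simpa [aTerm] using mem_zeroI S, ?_⟩
      have := encl_map_divNat (encl_trow hS (MI.mem_neg hL) len) (n := n0) (by omega)
      exact this.congr' fun i ↦ by simp [aTerm]
    have := encl_aPass hS len Ls (n0 + 1) _ (fun i ↦ g i + aTerm n0 i) (by omega)
      (hLs.2.congr' fun i ↦ by simp [add_assoc, add_comm 1 i]) (encl_addL hacc hrow)
    refine this.congr' fun i ↦ ?_
    rw [List.length_cons, show n0 + (Ls.length + 1) = n0 + 1 + Ls.length by omega,
      Finset.sum_eq_sum_Ico_succ_bot (show n0 < n0 + 1 + Ls.length by omega), add_assoc]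

/-! ### The shifted convolution -/

/-- [folklore] -/
@[simp] lemma length_dPass (S : ℕ) (G : List MI) : ∀ (ts trev : List MI),
    (dPass S G ts trev).length = ts.length
  | [], _ => rfl
  | t :: ts, trev => by simp [dPass, length_dPass]

/-- [folklore] -/
lemma encl_dPass (hS : 0 < S) {a : ℕ → ℝ} {G : List MI} (hG : Encl S a G) (t : ℕ → ℝ) :
    ∀ (ts trev : List MI) (i0 : ℕ), Encl S (fun m ↦ t (i0 + m)) ts → trev.length = i0 →
      Encl S (fun l ↦ t (i0 - 1 - l)) trev →
      Encl S (fun m ↦ ∑ l ∈ Finset.range (min G.length (i0 + m)), a l * t (i0 + m - 1 - l))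
        (dPass S G ts trev)
  | [], _, _, _, _, _ => trivial
  | T :: ts, trev, i0, hts, hlen, htrev => by
    simp only [dPass]
    refine ⟨?_, ?_⟩
    · have := mem_dot hS hG htrev
      rw [hlen] at this
      simpa using this
    · have htrev' : Encl S (fun l ↦ t (i0 + 1 - 1 - l)) (T :: trev) := by
        refine ⟨by simpa using hts.1, htrev.congr' fun l ↦ ?_⟩
        congr 1; omega
      have := encl_dPass hS hG t ts (T :: trev) (i0 + 1)
        (hts.2.congr' fun m ↦ by simp [add_assoc, add_comm 1 m]) (by simp [hlen]) htrev'
      refine this.congr' fun m ↦ ?_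
      simp only [show i0 + 1 + m = i0 + (m + 1) by omega]

/-! ### Widening by the Cauchy bound -/

/-- [folklore] -/
@[simp] lemma length_widenPass (S : ℕ) : ∀ (P : List MI) (e rinv : ℚ),
    (widenPass S P e rinv).length = P.length
  | [], _, _ => rfl
  | p :: P, e, rinv => by simp [widenPass, length_widenPass]

/-- [folklore] -/
lemma encl_widenPass (S : ℕ) : ∀ (P : List MI) (p u : ℕ → ℝ) (e rinv : ℚ),
    Encl S p P → (∀ i < P.length, |u i - p i| ≤ ((e * rinv ^ i : ℚ) : ℝ)) →
    Encl S u (widenPass S P e rinv)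
  | [], _, _, _, _, _, _ => trivial
  | I :: P, p, u, e, rinv, hP, herr => by
    simp only [widenPass]
    refine ⟨?_, ?_⟩
    · refine MI.mem_widen hP.1 ?_
      have h0 := herr 0 (by simp)
      simp only [pow_zero, mul_one] at h0
      have hS0 : (0 : ℝ) ≤ S := by positivity
      have : |u 0 - p 0| * S ≤ (e : ℝ) * S := mul_le_mul_of_nonneg_right h0 hS0
      exact_mod_cast this.trans (le_ceilScaled S e)
    · refine encl_widenPass S P (fun i ↦ p (i + 1)) (fun i ↦ u (i + 1)) (e * rinv) rinv hP.2 ?_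
      intro i hi
      have := herr (i + 1) (by simpa using hi)
      simpa [pow_succ, mul_assoc, mul_comm, mul_left_comm] using this

/-! ### The `q`-recursion -/

/-- [folklore] -/
lemma qPass_spec (hS : 0 < S) {uR qR : ℕ → ℝ}
    (hrec : ∀ m, qR m = (m + 1) * uR (m + 1) - ∑ i ∈ Finset.range m, uR (i + 1) * qR (m - 1 - i))
    {us : List MI} (hus : Encl S (fun i ↦ uR (i + 1)) us) :
    ∀ (c : ℕ) (rest : List MI) (m : ℕ) (qrev : List MI),
      Encl S (fun i ↦ uR (m + 1 + i)) rest → c ≤ rest.length → m + c ≤ us.length →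
      qrev.length = m → Encl S (fun l ↦ qR (m - 1 - l)) qrev →
      (qPass S us rest m qrev c).length = m + c ∧
        Encl S (fun l ↦ qR (m + c - 1 - l)) (qPass S us rest m qrev c)
  | 0, rest, m, qrev, _, _, _, hlen, hq => by
    cases rest <;> exact ⟨by simpa [qPass] using hlen, by simpa [qPass] using hq⟩
  | c + 1, [], m, qrev, _, hc, _, _, _ => by simp at hc
  | c + 1, u :: rest, m, qrev, hrest, hc, hm, hlen, hq => by
    simp only [qPass]
    have hQ : MI.mem S (qR m) (((u.mulInt ((m : ℤ) + 1)).sub (dot S us qrev))) := by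
      have h1 : MI.mem S (uR (m + 1) * (((m : ℤ) + 1 : ℤ) : ℝ)) (u.mulInt ((m : ℤ) + 1)) :=
        MI.mem_mulInt (by simpa using hrest.1) _
      have h2 := mem_dot hS hus hq
      rw [hlen, min_eq_right (by omega)] at h2
      have := MI.mem_sub h1 h2
      convert this using 1
      rw [hrec m]; push_cast; ring
    have hq' : Encl S (fun l ↦ qR (m + 1 - 1 - l)) (_ :: qrev) :=
      ⟨by simpa using hQ, hq.congr' fun l ↦ by
        show qR (m - 1 - l) = qR (m + 1 - 1 - (l + 1))
        rw [show m + 1 - 1 - (l + 1) = m - 1 - l by omega]⟩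
    have := qPass_spec hS hrec hus c rest (m + 1) _
      (hrest.2.congr' fun i ↦ by
        show uR (m + 1 + (i + 1)) = uR (m + 1 + 1 + i)
        rw [show m + 1 + (i + 1) = m + 1 + 1 + i by omega])
      (by simpa using hc) (show m + 1 + c ≤ us.length by omega) (by simp [hlen]) hq'
    refine ⟨by rw [this.1]; omega, this.2.congr' fun l ↦ ?_⟩
    show qR (m + 1 + c - 1 - l) = qR (m + (c + 1) - 1 - l)
    rw [show m + 1 + c - 1 - l = m + (c + 1) - 1 - l by omega]

end CertKernel

end Literature.NumberTheory.LFunctions.Xiao2020
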